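import Mathlib

/-!
# SoloBlind — Lipschitz constants of a bivariate polynomial on the unit bidisc (ENGINE P)

The dressed pair scalar is delivered as a Taylor polynomial `P(X, η) = ∑ c q p · η^q · X^p` in the
scaled variables `‖X‖ ≤ 1`, `‖η‖ ≤ 1`.  `pairscalar.py` uses the Lipschitz constants
`LX = ∑ p ‖c q p‖` and `LG = ∑ q ‖c q p‖`; this file proves them:

* `norm_pow_sub_pow_le`  : `‖X^p - Y^p‖ ≤ p ‖X - Y‖` on the closed unit disc;
* `norm_monomial_sub_le` : `‖η^q X^p - η'^q X'^p‖ ≤ q ‖η - η'‖ + p ‖X - X'‖`;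
* `poly_lipschitz`       : `‖P(X,η) - P(X',η')‖ ≤ LX ‖X - X'‖ + LG ‖η - η'‖`.

Together with `SoloBlindGridLowerBound` this is the complete logic of the zero-freeness certificate.
-/

namespace Summit.AnomalousDissipation.SoloBlind.PolyLipschitz

open Finset

/-- `‖X^p - Y^p‖ ≤ p ‖X - Y‖` for `‖X‖, ‖Y‖ ≤ 1`. -/
theorem norm_pow_sub_pow_le {X Y : ℂ} (hX : ‖X‖ ≤ 1) (hY : ‖Y‖ ≤ 1) :
    ∀ p : ℕ, ‖X ^ p - Y ^ p‖ ≤ p * ‖X - Y‖ := by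
  intro p
  induction p with
  | zero => simp
  | succ p ih =>
      have h : X ^ (p + 1) - Y ^ (p + 1) = X * (X ^ p - Y ^ p) + (X - Y) * Y ^ p := by ring
      rw [h]
      calc ‖X * (X ^ p - Y ^ p) + (X - Y) * Y ^ p‖
          ≤ ‖X * (X ^ p - Y ^ p)‖ + ‖(X - Y) * Y ^ p‖ := norm_add_le _ _
        _ = ‖X‖ * ‖X ^ p - Y ^ p‖ + ‖X - Y‖ * ‖Y‖ ^ p := by rw [norm_mul, norm_mul, norm_pow]
        _ ≤ 1 * (p * ‖X - Y‖) + ‖X - Y‖ * 1 := by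
            gcongr
            · exact pow_le_one₀ (norm_nonneg _) hY
        _ = (↑(p + 1) : ℝ) * ‖X - Y‖ := by push_cast; ring

/-- Monomial increment on the unit bidisc. -/
theorem norm_monomial_sub_le {X X' η η' : ℂ} (hX : ‖X‖ ≤ 1) (hX' : ‖X'‖ ≤ 1)
    (hη : ‖η‖ ≤ 1) (hη' : ‖η'‖ ≤ 1) (q p : ℕ) :
    ‖η ^ q * X ^ p - η' ^ q * X' ^ p‖ ≤ q * ‖η - η'‖ + p * ‖X - X'‖ := by
  have h : η ^ q * X ^ p - η' ^ q * X' ^ p = (η ^ q - η' ^ q) * X ^ p + η' ^ q * (X ^ p - X' ^ p) := by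
    ring
  rw [h]
  calc ‖(η ^ q - η' ^ q) * X ^ p + η' ^ q * (X ^ p - X' ^ p)‖
      ≤ ‖(η ^ q - η' ^ q) * X ^ p‖ + ‖η' ^ q * (X ^ p - X' ^ p)‖ := norm_add_le _ _
    _ = ‖η ^ q - η' ^ q‖ * ‖X‖ ^ p + ‖η'‖ ^ q * ‖X ^ p - X' ^ p‖ := by
        rw [norm_mul, norm_mul, norm_pow, norm_pow]
    _ ≤ (q * ‖η - η'‖) * 1 + 1 * (p * ‖X - X'‖) := by
        gcongr
        · exact norm_pow_sub_pow_le hη hη' q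
        · exact pow_le_one₀ (norm_nonneg _) hX
        · exact pow_le_one₀ (norm_nonneg _) hη'
        · exact norm_pow_sub_pow_le hX hX' p
    _ = q * ‖η - η'‖ + p * ‖X - X'‖ := by ring

/-- The bivariate polynomial with coefficient family `c` on a finite index set `I ⊆ ℕ × ℕ`
(`(q, p) ↦ c q p · η^q · X^p`). -/
def evalPoly (I : Finset (ℕ × ℕ)) (c : ℕ → ℕ → ℂ) (X η : ℂ) : ℂ :=
  ∑ i ∈ I, c i.1 i.2 * η ^ i.1 * X ^ i.2

/-- Lipschitz bound on the unit bidisc with `LX = ∑ p ‖c‖`, `LG = ∑ q ‖c‖`. -/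
theorem poly_lipschitz (I : Finset (ℕ × ℕ)) (c : ℕ → ℕ → ℂ) {X X' η η' : ℂ}
    (hX : ‖X‖ ≤ 1) (hX' : ‖X'‖ ≤ 1) (hη : ‖η‖ ≤ 1) (hη' : ‖η'‖ ≤ 1) :
    ‖evalPoly I c X η - evalPoly I c X' η'‖
      ≤ (∑ i ∈ I, (i.2 : ℝ) * ‖c i.1 i.2‖) * ‖X - X'‖ + (∑ i ∈ I, (i.1 : ℝ) * ‖c i.1 i.2‖) * ‖η - η'‖ := by
  unfold evalPoly
  rw [← sum_sub_distrib]
  calc ‖∑ i ∈ I, (c i.1 i.2 * η ^ i.1 * X ^ i.2 - c i.1 i.2 * η' ^ i.1 * X' ^ i.2)‖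
      ≤ ∑ i ∈ I, ‖c i.1 i.2 * η ^ i.1 * X ^ i.2 - c i.1 i.2 * η' ^ i.1 * X' ^ i.2‖ := norm_sum_le _ _
    _ ≤ ∑ i ∈ I, ‖c i.1 i.2‖ * (i.1 * ‖η - η'‖ + i.2 * ‖X - X'‖) := by
        refine sum_le_sum fun i _ => ?_
        have h : c i.1 i.2 * η ^ i.1 * X ^ i.2 - c i.1 i.2 * η' ^ i.1 * X' ^ i.2
            = c i.1 i.2 * (η ^ i.1 * X ^ i.2 - η' ^ i.1 * X' ^ i.2) := by ring
        rw [h, norm_mul]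
        exact mul_le_mul_of_nonneg_left (norm_monomial_sub_le hX hX' hη hη' i.1 i.2) (norm_nonneg _)
    _ = (∑ i ∈ I, (i.2 : ℝ) * ‖c i.1 i.2‖) * ‖X - X'‖ + (∑ i ∈ I, (i.1 : ℝ) * ‖c i.1 i.2‖) * ‖η - η'‖ := by
        rw [sum_mul, sum_mul, ← sum_add_distrib]
        exact sum_congr rfl fun i _ => by ring

end Summit.AnomalousDissipation.SoloBlind.PolyLipschitz
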